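import Mathlib
import HarnessLib
import HarnessLib.Audit
import Summits.SmoothPoincare4.Statement
import Literature.Geometry.Lorentzian.PseudoRiemannianMetric
import Literature.Geometry.Lorentzian.LeviCivita
import Literature.Geometry.Lorentzian.EnergyCurrents
import Literature.Geometry.Lorentzian.Volume
import Literature.Geometry.Riemannian.RiemannianDistance
import Literature.Topology.FourManifolds.HomotopyS4CompactProofs
import Literature.Geometry.Riemannian.WeylEnergy
import HarnessLib.Audit.Status.Attr

/-!
Route: EntropyRung

DORMANT since 2026-08-24T06:32:36Z (reconciler: no traction for 6.6 d (last activity item-evidence-added at 2026-08-17T16:12:22Z); parked, not closed — `ledger route dormant route-SmoothPoincare4-EntropyRung --off` to reactivate) — unstaffed, not closed; items shared with open routes are served there. `ledger route dormant <id> --off` reactivates.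

# Route EntropyRung — fake 4-spheres are entropically sub-cylindrical — Perelman ν above the S³×ℝ
density recognises S⁴ with no surgery, modulo two shrinker density gaps

It suffices to show X = RUNG ∧ ENT (card perelman-entropy-subcylindrical). Put ν_cyl := log Θ(S³×ℝ)
= log 2 + ½ log π − 3/2 ≈ −0.2345
and ν(g) := inf_{τ>0} μ(g,τ) (Perelman's entropy μ(g,τ) = inf over smooth f with ∫ u dV = 1, u =
(4πτ)⁻² e^{−f}, of
𝒲(g,f,τ) = ∫ [τ(R + |∇f|²) + f − 4] u dV; `g.muEntropy` of
Literature/Geometry/Riemannian/PerelmanEntropy.lean). RUNG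
(SubcylindricalRecognition): a Riemannian metric with scalar curvature R > 0 and ν(g) > ν_cyl on a
smooth homotopy 4-sphere M forces
M ≅ S⁴ — because along its Ricci flow every singularity model has Gaussian density ≥ e^{ν(g)} >
Θ(S³×ℝ) = .791, and in the
4-dimensional density table the ONLY non-flat shrinker above the cylinder is the round S⁴ (6/e² =
.812): necks, bubble-sheets, FIK,
Kähler and orbifold models are all forbidden at once, so no surgery is needed. ENT
(SubcylindricalExistence): every smooth homotopy
4-sphere carries such a metric (the round S⁴ does: ν = log 6 − 2 ≈ −0.2083, margin 0.026). RUNG is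
reduced to two typed density-gap
statements about gradient shrinking Ricci solitons (NoncompactShrinkerGap, CompactShrinkerGap) plus
Bamler's 2020 singular-time theory.
TYPING (rev 1, cone repair 2026-08-15): the four cruxes are spelled over the FACT-FREE vocabulary —
dV = `riemannianMeasure
(g.toContMDiffRiemannianMetric hg)` (Volume.lean; = `g.riemVolume` by `riemVolume_eq hg`), distance
`g.edist hg` (RiemannianDistance.lean;
= `g.riemEDist` by `riemEDist_eq hg`), and "ν(g) > ν_cyl" as ∃ δ > 0 ∀ τ > 0 ∀ f smooth with ∫
(4πτ)^{−4/2} e^{−f} dV = 1,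
ν_cyl + δ ≤ ∫ [τ(R + |∇f|²) + f − 4] (4πτ)^{−4/2} e^{−f} dV (= `(ν_cyl + δ : EReal) ≤ g.muEntropy
g.leviCivita τ` by `le_muEntropy_iff`,
`scalarCurvatureWith_leviCivita`, `finrank_euclideanSpace_fin`) — the same propositions as at open,
with `μ`, `riemVolume`, `riemEDist`
unfolded one step so that the route imports only Literature modules whose every named fact is
proved.
Lean: `SubcylindricalRecognition ∧ SubcylindricalExistence`

## Assembly
The deciding theorem `closes : SubcylindricalRecognition → SubcylindricalExistence →
SmoothPoincare4` is PROVED in the route file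
(D-0027 §2.1; axioms propext / Classical.choice / Quot.sound): given RUNG and ENT, for M with the
summit binder (Hausdorff, second-countable,
any C^∞ atlas on ℝ⁴) and e : M ≃ₕ S⁴, the proved theorem
`Literature.Topology.FourManifolds.compactSpace_of_homotopyEquiv_sphere_four_holds`
(Hatcher Prop. 3.29) gives compactness, compact + T₂ ⇒ T₃ (Mathlib instances) and the Borel
σ-algebra `borel M` discharge the instance
hypotheses; ENT supplies g with R > 0 and ν(g) > ν_cyl; RUNG returns M ≃ₘ S⁴, i.e. SmoothPoincare4.
No named fact is a hypothesis of the
assembly: all conditional content (Perelman monotonicity, Bamler, the density gaps) sits inside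
RUNG. The support item `Assembly`
(RUNG → ENT → SmoothPoincare4) is the same implication as a Prop and is provable now by the same six
lines.

Rationale: WHY THIS LINE. Cao–Hamilton–Ilmanen (CaoHamiltonIlmanen2004 §3–4) observed that e^{ν(g₀)} is a floor
for the central density Θ of every later
singularity model and printed the 4-d table 1 > .812 (S⁴) > .791 (S³×ℝ) > .736 (S²×ℝ²) > .672 (FIK)
> .609 (ℂP²) > … ; nobody drew the
topological conclusion that in dimension 4 the sphere sits ABOVE every non-compact model, so an
entropy floor above the cylinder excludes
all non-round singularities simultaneously — the opposite bookkeeping to the mean-curvature-flow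
low-entropy programme
(ColdingIlmanenMinicozziWhite2013, BernsteinWang2016/2018), where the sphere has the LEAST entropy
and necks must be handled by surgery.
Bamler's compactness/structure theory (Bamler2023, Bamler2020Structure §2.6, §2.10) now supplies
exactly what the argument needs in
dimension 4 without curvature pinching: tangent flows at the first singular time exist at every
singular point, are non-flat orbifold
gradient shrinkers with isolated singularities, and inherit the entropy floor; a compact smooth
tangent flow forces global smooth
convergence. Bamler2021Notices judges flows THROUGH singularities unlikely to reach SPC4; this line
never continues through one — above
the cylinder density there is nothing to continue through. Imported areas: parabolic geometric
analysis (Perelman's 𝒲/μ/ν = optimal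
scale-families of log-Sobolev inequalities, Perelman2002Entropy; Carrillo–Ni's identity μ(g,1) =
𝒲(g,f,1) on shrinkers,
CarrilloNi2009), heat-kernel/metric-flow theory (Bamler), and the soliton classification programme
(LiWang2019/2020/2024,
MunteanuWang2015/2019, KotschwarWang2015, ChowKotschwarMunteanu2025); no spectral/probabilistic
reformulation. Versus route PIC
(pointwise curvature cone + HCTZ surgery) and route WeylBudget (elliptic CGY recognition), the
hypothesis here is one global
parabolic inequality and the recogniser is a density ORDERING of solitons; the negatives index is
empty.

RANKED CRUXES. #2 NoncompactShrinkerGap (crux) — (card G-ends, sharpened) the round cylinder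
maximises the Gaussian density among complete NON-COMPACT non-flat 4-dimensional gradient shrinking
Ricci solitons: for (M⁴, g, f) connected, non-compact, complete (closed g-balls compact), Ric + Hess
f = g/2, normalised by R + |∇f|² = f, and R ≢ 0, one has (4π)⁻² ∫_M e^{−f} dV ≤ Θ(S³×ℝ) = 2√π
e^{−3/2} ≈ .791, i.e. ∫ e^{−f} dV ≤ 32π²√π e^{−3/2} ≈ 124.9 (by CarrilloNi2009 / LiWang2019 (2.5)
the left side is e^{μ(g,1)} = CHI's central density; equality for S³×ℝ, S³/Γ×ℝ give .791/|Γ|, S²×ℝ²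
.736, FIK .672). Typed (rev 1) over the fact-free cone: dV = riemannianMeasure
(g.toContMDiffRiemannianMetric hg), closed balls of g.edist hg compact; the two soliton clauses are
`g.IsNormalisedShrinker f 1` unfolded and the bound is `g.shrinkerDensity f 1 ≤ Θ(S³×ℝ)` unfolded
(GradientShrinker.lean: isNormalisedShrinker_one_iff, shrinkerDensity_def). [difficulty:
open-problem] (why it might fail: Only inexplicit gaps are known at both ends of the window (Θ <
1−δ₀: Yokota2009/LiWang2020; PGH-rigidity of S³×ℝ: LiWang2024 Thm 1.1); an unclassified non-compact
4-d shrinker — BCCD 2024 (density never computed) or a non-Kähler conical one — may have Θ ∈ (.791,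
1).) [CaoHamiltonIlmanen2004, LiWang2024, LiWang2020, LiWang2019, Yokota2009, CarrilloNi2009,
MunteanuWang2019, KotschwarWang2015, FeldmanIlmanenKnopf2003, BamlerEtAl2024, ConlonDeruelleSun2024,
ChowKotschwarMunteanu2025]
#3 SubcylindricalRecognition (crux) — (card RUNG) for a closed smooth 4-manifold M ≃ₕ S⁴ and a
Riemannian metric g with Levi-Civita connection, if scal_g > 0 everywhere and ν(g) > ν_cyl (typed: ∃
δ > 0, ∀ τ > 0, μ(g,τ) ≥ log 2 + ½ log π − 3/2 + δ), then M is diffeomorphic to S⁴. Intended proof: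
R > 0 ⇒ singular time T ≤ 2/R_min (in tree); μ-monotonicity ⇒ every tangent flow at (x,T), x in
Bamler's singular slice M_T, is a non-flat orbifold gradient shrinker with log Θ = 𝒩_{x,T}(0) ≥ ν(g)
> ν_cyl; NoncompactShrinkerGap + (orbifold points force Θ ≤ 1/2) + CompactShrinkerGap leave only a
compact model diffeomorphic to S⁴, and a compact smooth tangent flow N of a flow on connected closed
M gives M ≅ N. Typed (rev 1): the entropy hypothesis is ∃ δ > 0 ∀ τ > 0 ∀ f smooth with ∫
(4πτ)^{−4/2} e^{−f} dV = 1, ν_cyl + δ ≤ ∫ [τ(R + |∇f|²) + f − 4] (4πτ)^{−4/2} e^{−f} dV, dV =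
riemannianMeasure (g.toContMDiffRiemannianMetric hg) — literally `(ν_cyl + δ : EReal) ≤ g.muEntropy
g.leviCivita τ` unfolded (le_muEntropy_iff, riemVolume_eq, scalarCurvatureWith_leviCivita,
finrank_euclideanSpace_fin). [deps: NoncompactShrinkerGap, CompactShrinkerGap] [difficulty: XL] (why
it might fail: Proof = Perelman monotonicity + Bamler's singular-time tangent flows (2009.03243
§2.6/§2.10) + BOTH density gaps + orbifold shrinkers have Θ ≤ 1/2; one non-round (orbifold) 4-d
shrinker with Θ ∈ (.791, 1) kills it as stated, and none of Bamler's package is in the library.)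
[Perelman2002Entropy, CaoHamiltonIlmanen2004, Bamler2020Structure, Bamler2023, Bamler2020Entropy,
LiWang2019, Topping2006]
#4 CompactShrinkerGap (crux) — (card G-compact, restricted to what the rung needs) a closed smooth
4-manifold M ≃ₕ S⁴ carrying a gradient shrinking soliton structure (g, f), Ric + Hess f = g/2, R +
|∇f|² = f, of Gaussian density (4π)⁻² ∫ e^{−f} dV > Θ(S³×ℝ) is diffeomorphic to S⁴. Einstein
sub-case (f constant): W⁺ ≡ 0 forces W ≡ 0 (σ = 0) hence constant curvature (Hitchin1974) hence S⁴
(Kuiper, in tree); W^± ≢ 0 forces ∫|W^±|² ≥ ∫R²/24 each (Gursky2000), so with χ = 2, Vol ≤ Vol(S⁴)/3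
and Θ ≤ 2/e² = .271 < .791. Live part: non-Einstein compact shrinkers on homotopy spheres. Typed
(rev 1) with dV = riemannianMeasure (g.toContMDiffRiemannianMetric hg) (= g.riemVolume,
riemVolume_eq hg); clauses = `g.IsNormalisedShrinker f 1`, hypothesis = `Θ(S³×ℝ)·16π² < ∫ e^{−f} dV`
i.e. `shrinkerDensity f 1 > Θ_cyl` unfolded. [difficulty: L] (why it might fail: Einstein case is
closed (Hitchin1974: W⁺≡0 ⇒ round; Gursky2000: else Vol ≤ Vol(S⁴)/3, Θ ≤ .271), but compact
NON-Einstein 4-d shrinkers with b₂ = 0 are unclassified — none known, no theorem excludes one of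
density > .791 on an exotic Σ, where the statement is SPC4-hard.) [Hitchin1974, Gursky2000,
CaoHamiltonIlmanen2004, ChengZhou2023, LiNiWang2016, HaslhoferMuller2011, Kuiper1949,
CarrilloNi2009]
#5 SubcylindricalExistence (crux) — (card ENT) every closed smooth 4-manifold M ≃ₕ S⁴ carries a
Riemannian metric g (with Levi-Civita connection) with scal_g > 0 and ν(g) > ν_cyl, i.e. ∃ δ > 0 ∀ τ
> 0, μ(g,τ) ≥ log 2 + ½ log π − 3/2 + δ. True on S⁴ (round metric: ν = log 6 − 2, δ = 0.026); with
the rung it is ⇔ SPC4. Attack (card): maximise ν over {R > 0} — constrained critical points are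
shrinkers on Σ — and localise to asymptotically Euclidean metrics on the punctured Σ° via ν(Σ) ≥
min(ν_rd, ν_AE(Σ°)) − o(1). Typed (rev 1) exactly as the hypothesis of SubcylindricalRecognition (∃
g, ∃ Levi-Civita instance, ∃ hg : g Riemannian, R > 0 ∧ the unfolded ν-bound), so that `closes` is
six lines. [deps: SubcylindricalRecognition] [difficulty: open-problem] (why it might fail: ⇔ SPC4
given the rung, so false iff an exotic S⁴ exists; as a programme: ν is not monotone under the
codim-2/3 regluings producing Σ from S⁴ (neck-stretching drives ν below ν_cyl), so no construction
of a super-cylindrical metric is known on a Σ not already identified with S⁴.) [Perelman2002Entropy,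
CaoHamiltonIlmanen2004, Topping2006, Bamler2021Notices, CarrilloNi2009]
#6 ChangGurskyYang (crux; attached at rev 2 by route-choice a8c60df1, shared with route WeylBudget
where it is support rank 9) — NAMED-FACT ITEM, verbatim
`Literature.Geometry.Riemannian.changGurskyYang_sphere_four` (Chang–Gursky–Yang 2003 Thm A, simply
connected R > 0 case): a compact simply connected smooth 4-manifold with a C^∞ metric of R > 0 and
Weyl energy ∫|W|² dV < 32π² ((0,4)-norm) is ≅ S⁴; it is the recogniser consumed as `hCGY` by the
picked line cgy-variance-pivot of CompactShrinkerGap. [difficulty: XL] (why it might fail: published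
theorem, false only by a vendoring slip; as a Lean target CGB-4, Margerin1998 and CGY Thm 1.4 are
all absent.) [ChangGurskyYang2003, Margerin1998, arXiv:math/0309287]
#9 GLUE (support, rev 3 = this unused-crux repair; no statement changed, `closes` unchanged):
RecognitionOfShrinkerGaps : NoncompactShrinkerGap → CompactShrinkerGap → SubcylindricalRecognition
and CompactGapOfChangGurskyYang : ChangGurskyYang → CompactShrinkerGap — exactly the two
implications the picked lines already prove modulo their stubs (`SubcylindricalRecognition_of h₂ h₄`
of Lines/ancient-sphere-rigidity, stmt-10869; `CompactShrinkerGap_of hCGY` of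
Lines/cgy-variance-pivot, stmt-10870), filed as items so that ranks 2, 4 and 6 sit in the cone of
`closes`: SubcylindricalRecognition and CompactShrinkerGap become DERIVED, and the open leaves are
NoncompactShrinkerGap, ChangGurskyYang, SubcylindricalExistence and the two glue items.
#1 Assembly (assembly, bookkeeping) — SubcylindricalRecognition → SubcylindricalExistence →
SmoothPoincare4; provable now by the proof of the deciding theorem `closes` (rev 1, D-0027 §2.1:
compactness of M ≃ₕ S⁴ from the proved tree theorem compactSpace_of_homotopyEquiv_sphere_four_holds,
T₃ and Borel instances from Mathlib). The rank-0 target EntropyThesis (RUNG ∧ ENT) of rev 0 is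
DROPPED in rev 1: it is the bare conjunction of two cruxes, and as a rank-0 item it referenced decls
rendered after it (blocked_missing_decls, never elaborated); the thesis line `Lean:` keeps X = RUNG
∧ ENT.

KILL CRITERIA. An explicit non-compact (or orbifold) 4-d shrinker with Θ ∈ (.791, .812) refutes
NoncompactShrinkerGap but not the line: PIVOT by
`--restate` of all three thresholds from Θ(S³×ℝ) to that Θ (the rung survives with margin .812 − Θ).
A non-round shrinker of any kind
with Θ ≥ Θ(S⁴) = 6/e² kills the mechanism (the sphere no longer tops the table): `close --reason
refuted:NoncompactShrinkerGap`. A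
refutation of CompactShrinkerGap or of SubcylindricalExistence exhibits an exotic 4-sphere (¬SPC4):
the route closes with the problem.
A proof that ν(g) ≤ ν_cyl for every R > 0 metric on some family BELIEVED standard (e.g. all Gluck
twists) does not refute an item but
retires the existence programme: pivot the route to the recogniser-only conditional bridge. SPC4
proved elsewhere moots everything.

NOT DECOMPOSED YET. Bamler's package (F-convergence, metric flows/solitons, the singular time-slice
M_T, ε-regularity, "compact smooth tangent flow ⇒
global convergence") and Perelman's μ-monotonicity (T2) as Literature named facts — none is in the
library and the first needs a large
new vocabulary; orbifold shrinkers and the local-density bound Θ ≤ 1/|Γ| at an orbifold point; the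
split lemma Θ(N³×ℝ) = Θ(N³) ≤ Θ(S³)
(3-d shrinker classification); the support consistency statement ν(S⁴_round) = log 6 − 2 (needs
RoundSphere.lean + sharp log-Sobolev on
S⁴ — deliberately not filed at open to keep the import cone small); the AE localisation of ENT (AE
log-Sobolev constants on open
4-manifolds; the tree's asymptotic-flatness files are 3+1 Lorentzian); numerics of Θ for BCCD /
Conlon–Deruelle–Sun shrinkers (kit,
refuter's first job). All are layer-2 children or cite/definition items, later. NAMED FACTS the two
glue items will be proved modulo (to be itemised as NAMED-FACT support items in the manner of
ChangGurskyYang, or discharged as `_holds`, when a lead asks — until then such a proof is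
`proof.conditional`): F1 `ricciFlow_shortTime_existence`, F2 `perelman_muEntropy_monotone`, the
Bamler 2020abc export of line ancient-sphere-rigidity r5 (for RecognitionOfShrinkerGaps);
`chernGaussBonnet_four` only for the variance form of the Weyl budget (CompactGapOfChangGurskyYang
via `stub_weylBudget` needs none). The finer item `WeylBudget` (= the signature of
`stub_weylBudget`, suggested by the lead of stmt-10870) is deliberately not filed at rev 3:
CompactGapOfChangGurskyYang carries exactly that content; a tenure planner may itemise it. COSMETIC
(not blocking anyone): once refactor wi-20015 (slim homes for riemVolume / riemEDist /
scalarCurvatureWith, prepared and verified, blocked only on an operator multi-file write) gives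
PerelmanEntropy.lean and GradientShrinker.lean a fact-free import cone, a tenure planner MAY re-type
the four cruxes 1:1 (`--restate`) over `g.muEntropy` / `g.riemVolume` / `g.IsNormalisedShrinker f 1`
/ `g.shrinkerDensity f 1` by the dictionary in the thesis; provers do not need this — Theorems files
may import PerelmanEntropy / GradientShrinker(Proofs) freely and `rw` by riemVolume_eq,
riemEDist_eq, le_muEntropy_iff, isNormalisedShrinker_one_iff, shrinkerDensity_def. NEEDS-FACT: none
— no item uses any of the 29 unproved facts of the rev-0 import cone (the native `#h21_route_deps`
cone of rev 0 was already proposition-free; the debt was import-closure baggage of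
CanonicalNeighbourhoods.lean: EvolvingNecks → the FourManifolds gluing pile, RicciFlowMaximal →
RicciFlow), and rev 1 imports only PseudoRiemannianMetric, LeviCivita, EnergyCurrents, Volume,
RiemannianDistance, HomotopyS4CompactProofs, all of whose closed named facts have `_holds` proofs.

CHEAPEST FALSIFIER. (a) Compute the Gaussian density of the Bamler–Cifarelli–Conlon–Deruelle
shrinker (BamlerEtAl2024, toric on Bl₁(ℂ×ℙ¹)) and re-derive
FIK's .672 from the same code (kit ODE/quadrature on the published U(2)/toric data): a value in
(.791, .812) forces the pivot above,
≥ .812 kills the line. (b) Lookup in ChowKotschwarMunteanu2025 (not held; want filed) and LiWang2019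
§6 / LiWang2024 §6 whether
"Θ ≤ Θ(S^{n−1}×ℝ) for non-compact non-flat shrinkers" is already conjectured, proved in a class, or
contradicted by a known example.
I could run neither here (galaxy/arXiv rate-limited this session; no kit in plancard mode); the
table entries themselves were
re-derived by hand: Θ(S⁴) = 96π²e⁻²/(16π²) = 6/e², Θ(S³×ℝ) = 2√π e^{−3/2}, ratio 1.0266.

TWO-LAYER PLAN. SubcylindricalRecognition ⇐ DensityFloor (closed 4-d Ricci flow with R > 0: every
tangent flow at the singular time is a non-flat orbifold
gradient shrinker with log Θ ≥ ν(g₀) — Perelman (T2) + Bamler2020Structure §2.6/§2.10, needs F-limit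
/ metric-soliton vocabulary) →
ModelGap (NoncompactShrinkerGap ∧ CompactShrinkerGap ∧ "an orbifold point of order |Γ| forces Θ ≤
1/|Γ| ≤ 1/2" ⇒ the only model with
Θ > Θ_cyl for a flow on M ≃ₕ S⁴ is compact, smooth and ≅ S⁴) → CompactModel (a compact smooth
tangent flow N of a flow on a connected closed
M gives M ≅ N) → SubcylindricalRecognition. CompactShrinkerGap ⇐ HighDensityIsEinstein (compact
shrinker on M ≃ₕ S⁴ with Θ > Θ_cyl has
Hess f ≡ 0) → EinsteinDense (Einstein, χ = 2, σ = 0, Vol > Vol(S⁴)/3 ⇒ constant curvature: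
Hitchin1974 + Gursky2000, cite facts) →
(constant curvature + π₁ = 1 ⇒ ≅ S⁴: Kuiper, `kuiper_conformallyFlat_sphere_four_holds` in tree) →
CompactShrinkerGap.
SubcylindricalExistence ⇐ RoundBound (ν(S⁴_round) = log 6 − 2 > ν_cyl; sharp scale-family of
log-Sobolev inequalities on S⁴) →
GluingLowerBound (ν(Σ) ≥ min(ν_rd, ν_AE(Σ°)) − o(1) for metrics round outside a shrinking copy of
the fake ball) → AEEntropy (AE metrics
on the punctured Σ° with scale-uniform log-Sobolev deficit < 0.2345) → SubcylindricalExistence. k ≤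
3 each, depth 1; no split filed. Filed at rev 3 (top level, kind support, no new layer):
RecognitionOfShrinkerGaps = DensityFloor → ModelGap → CompactModel collapsed into the one
implication `gaps ⇒ rung` over the route's own decls (the cone-point exclusion Θ ≤ 1/|Γ| lives
inside its proof, on the compact approximants: μ ≤ −log|Γ| + o(1) < ν_cyl + δ), and
CompactGapOfChangGurskyYang = the CGY door of CompactShrinkerGap actually taken by the picked line
(R > 0 landed, π₁ = 1 proved, open content = the Weyl budget ∫|W|² < 32π² for dense shrinkers on
homotopy 4-spheres ⟺[CGB, χ = 2] ∫(R − 2)² dV < 2·Vol − 96π², margin 96π² at S⁴(√6)); the Einstein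
chain HighDensityIsEinstein → EinsteinDense above survives as the landed sub-case
`compactShrinkerGap_einstein` (p72766).

NUMBERS. CHI table (CaoHamiltonIlmanen2004 §4, read this session p.7): Θ(ℝ⁴) = 1; S⁴ 6/e² = .812;
S³×ℝ 2(π/e³)^{1/2} = .791; S²×ℝ² 2/e = .736;
FIK blow-down .672; ℂP² 9/2e² = .609; S²×S² .541; Koiso .518; Page .517; C(ℝP³), C(ℝP²)×ℝ .500; ℝP⁴
.406; … ; ℂP²#5(−ℂP²) KE 2/e² = .271.
Thresholds: ν_cyl = log 2 + ½ log π − 3/2 = −0.23449, ν_rd = log 6 − 2 = −0.20824, margin 0.02625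
(density ratio 1.0266). Typed
normalisation (τ = 1, Ric + Hess f = g/2, R + |∇f|² = f): Θ = (4π)⁻² ∫ e^{−f} dV = e^{μ(g,1)}
(CarrilloNi2009 Thm 1.1; LiWang2019 (2.5));
cylinder S³(2)×ℝ: R = 3/2, f = z²/4 + 3/2, ∫ e^{−f} dV = 32π²√π e^{−3/2} ≈ 124.9; sphere S⁴(√6): R =
2, f ≡ 2, ∫ e^{−f} dV = 96π² e⁻² ≈ 128.2.
Gaps known: μ(g,1) < −δ₀(n) for every non-flat shrinker (Yokota2009; LiWang2020 Thm 1.3), δ₀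
inexplicit; S^{n−1}×ℝ PGH-rigid among
shrinkers (LiWang2024 Thm 1.1), ε inexplicit; Einstein on a homotopy 4-sphere: round or Vol ≤
Vol(S⁴)/3 (Hitchin1974, Gursky2000).
Items at open: 6 (1 target, 4 cruxes, 1 assembly); rev 1 (cone/glue repair 2026-08-15): 5 items (4
cruxes restated 1:1 over the fact-free vocabulary, 1 assembly) + the proved deciding theorem
`closes`; imports 5 → 6 slim modules; unproved named facts in the import cone 29 → 0.

DEFINITION REQUESTS. (1) LANDED: `g.IsGradientShrinker f τ` / `g.IsNormalisedShrinker f τ` /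
`g.shrinkerDensity f τ` and the named fact `carrilloNi_muEntropy_eq_log_shrinkerDensity`
(Carrillo–Ni 2009 Cor. 4.1, closed case) in Literature/Geometry/Riemannian/GradientShrinker.lean (+
GradientShrinkerProofs, ShrinkerEntropy.lean: CarrilloNi2009_shrinkerLSI); they import
PerelmanEntropy and therefore enter the ROUTE TEXT only after wi-20015 (see NOT DECOMPOSED YET) —
until then the cruxes carry the clauses inline (dictionary: isNormalisedShrinker_one_iff,
shrinkerDensity_def). (1b) refactor wi-20015 (kind refactor, Geometry/Riemannian): slim
RiemannianVolume.lean + ScalarCurvatureWith.lean, blocked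
`other:atomic-multifile-move-needs-operator`, all five files attached there.
(2) Cite facts wanted: Perelman's monotonicity of μ along the Ricci flow (Perelman2002Entropy §3.1
(3.4); Topping2006 (8.3.10) — it is
hypothesis (T2) of PerelmanEntropyNoncollapsing.lean, not yet a named fact); Carrillo–Ni 2009 Thm
1.1; scalar curvature of a complete
non-flat shrinker is positive (Chen 2009 / Zhang 2009); Hitchin1974 Thm + Gursky2000 Thm 1 (Einstein
4-manifolds); Bamler2020Structure
§2.6 singular-time theorem and §2.10 (4-d orbifold structure) — long-range, needs F-convergence
vocabulary first.

Novelty: Searches (2026-08-15, this session; OpenAlex/arXiv APIs 429, searchd local FTS reset, so zbMATH +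
galaxy + vsearch + full reads):
zbMATH "rigidity cylinders Ricci shrinkers" (4: LiWang2024, CIM 2015, Li–Zhang 2023),
"four-dimensional shrinking Ricci solitons" (25:
Munteanu–Wang, Kotschwar–Wang, Li–Ni–Wang, Cheng–Zhou, Cao–Ribeiro–Zhou, Naber,
ChowKotschwarMunteanu2025 …), "entropy gap shrinking Ricci
soliton" (3, none relevant), "Gaussian density Ricci solitons" (3: CHI, Yokota addendum), "Ricci
flow entropy singularity models low
entropy classification" (2: Langford 2025 book, Mramor MCF), "Perelman entropy sphere theorem" (15,
surveys only), "Bamler Ricci flow" (30),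
"heat kernel Ricci shrinkers Li Wang" (2), "Perelman reduced volume gap theorem" (3); `lit vsearch`
of the rung in prose (0 relevant in
5.26M chunks); `lit galaxy search --star all` "gradient shrinking Ricci soliton" (22 rows: Chow's
soliton books, Conrado–Zhou, Naff–Ozuch,
Huang ε-regularity of 4-d shrinkers, Cabezas-Rivas–Topping — none an entropy-threshold recognition
theorem), "Gaussian density of the
shrinker" / "shrinking solitons in dimension four" (0); full-text reads: Bamler2020Structure
§2.2/§2.6/§2.10, LiWang2024 §1/§6 (Conj.
6.2, 6.4), LiWang2019 §1–2/§6 (Thm 2.2 = Carrillo–Ni, Conj. 6.1–6.3), LiWang2020 Thm 1.3,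
CaoHamiltonIlmanen2004 pp.1,5,7; plus the card's
and the triage refuter's logged searches (galaxy intelligent pdf 25 rows, zbMATH 4 queries:
nothing).
Nearest prior art found: CaoHamiltonIl  [refs: 10.4310/jdg/1717772425:, math/0404165, 2009.03243, doi:10.4310/jdg/1717772425, ChowKotschwarMunteanu2025, ColdingIlmanenMinicozziWhite2013, BernsteinWang2018]

Barriers (technique_class: ricci-flow-entropy-threshold, soliton-density-gap): - technique_class: ricci-flow-entropy-threshold, soliton-density-gap
- Literature.Barriers.SmoothPoincare4.GaugeSumBarrierFour: not engaged — no invariant is evaluated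
on Σ or on Σ # Y; ν(Σ) := sup{ν(g) : R_g > 0} is a diffeomorphism invariant defined by optimisation
over metrics, and the line uses it only through the recogniser "ν(Σ) > ν_cyl ⇒ Σ ≅ S⁴", never
additively under connected sum (were it used as an exotic-DETECTOR via sums, sum-stability would
have to be checked; we do not).
- Literature.Barriers.SmoothPoincare4.StableBarrierFour: not engaged — nothing is S²×S²-stable here
(ν and Θ change under # S²×S²: Θ(S²×S²) = .541), and the conclusion is a diffeomorphism, not
equality of an invariant.
- Literature.Barriers.SmoothPoincare4.HCobordismInvariantBarrierFour: not engaged for the same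
reason; the h-cobordism to S⁴ is never used.
- Literature.Barriers.SmoothPoincare4.TopologicalBarrierFour: not engaged — ν(g) depends on the
smooth metric, not on the homeomorphism type; positive side only.
- Literature.Barriers.SmoothPoincare4.HCobordismBarrierFour: evaded — the diffeomorphism comes from
smooth convergence of the rescaled Ricci flow to a compact round tangent flow (Bamler), not from
"h-cobordant ⇒ diffeomorphic".
- Literature.Barriers.SmoothPoincare4.TwistedSphereBarrierFour: consistent — Γ₄ = 0 / Cerf is not
invoked; a diffeomorphism is produced directly.
- Literature.Barriers.SmoothPoincare4.GluckTwistCP2Barrier: not applicable (it blocks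
invariant-based refutations

Novelty grade: new-combination — NEW-COMBINATION (route-review refuter 1a4b8c33; = card grade by triage-12-0). SEARCHED: zbMATH 'Gaussian density shrinking Ricci soliton' (2: CHI, Yokota), 'Ricci shrinkers entropy' (25: Cao–Zhu, Haslhofer–Müller, Li–Li–Wang, Li–Wang, Chan–Zhang arXiv:2605.08884, …), 'entropy gap … cylinder Li Wang' (refuter refuter-rreview-route-AtomisticToContinu-1a4b8c33-0, 2026-08-15T14:05:06Z; prior: arXiv:math/0404165, arXiv:2009.03243, arXiv:2008.09298, doi:10.4310/jdg/1717772425, doi:10.4310/jdg/1375124609, BernsteinWang2018, arXiv:2605.08884, CarrilloNi2009)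

History (route lifecycle, newest last):
- 2026-08-15T16:25:34Z · rev 1: restated NoncompactShrinkerGap (stmt-SmoothPoincare4-6808), SubcylindricalRecognition (stmt-SmoothPoincare4-6809), CompactShrinkerGap (stmt-SmoothPoincare4-6810), SubcylindricalExistence (stmt-SmoothPoincare4-6811) — route-repair (cone + glue, planner-rbadge-SmoothPoincare4-EntropyRung-77b91637-g4-0): RE-ROUTED  (planner-rbadge-SmoothPoincare4-EntropyRung-77b91637-g4-0)
- 2026-08-15T16:25:34Z · rev 1: dropped EntropyThesis — route-repair (cone + glue, planner-rbadge-SmoothPoincare4-EntropyRung-77b91637-g4-0): RE-ROUTED AROUND the 29 unproved import-cone facts (none used by any item) (planner-rbadge-SmoothPoincare4-EntropyRung-77b91637-g4-0)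
- 2026-08-24T06:32:36Z · DORMANT — reconciler: no traction for 6.6 d (last activity item-evidence-added at 2026-08-17T16:12:22Z); parked, not closed — `ledger route dormant route-SmoothPoincare4- (operator:999:3722177)

sub-problem: SmoothPoincare4 · status: dormant · opened planner-plancard-SmoothPoincare4-SmoothPoinca-29a493c1-0 2026-08-15T11:52:55Z · rev 5 · ledger route-SmoothPoincare4-EntropyRung
GENERATED by the gate from the ledger (D-0016/17). Provers cite these decls: `theorem foo : Summit.SmoothPoincare4.SmoothPoincare4.Theses.EntropyRung.<Decl> := …` in Summits/SmoothPoincare4/SmoothPoincare4/Theorems/<Name>.lean.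
-/

namespace Summit.SmoothPoincare4.SmoothPoincare4.Theses.EntropyRung

open scoped BigOperators Topology Manifold Classical MeasureTheory ProbabilityTheory Matrix InnerProductSpace ComplexConjugate ContinuousMap ContDiff
open Filter Set Function TopologicalSpace MeasureTheory

attribute [summit_statement] _root_.SmoothPoincare4

open Literature.SPC4

-- earlier NoncompactShrinkerGap (stmt-SmoothPoincare4-6808, replaced 2026-08-15T16:25:34Z -> stmt-SmoothPoincare4-10868): retired by None — ∀ (M : Type) [TopologicalSpace M] [T2Space M] [SecondCountableTopology M] [ChartedSpace (EuclideanSpace ℝ (Fin 4)) M] [IsManifold (𝓡 4) ∞ M] [ConnectedSpace M] [NoncompactSpace M] [T3Space M] [MeasurableSpace M] [BorelSpace M] (g : Literature.Geometry.Lorentzian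
/-- item stmt-SmoothPoincare4-10868 · crux · rank 2 · open · by planner
why it might fail: Only inexplicit gaps are known at both ends of the window (Θ < 1−δ₀: Yokota2009/LiWang2020; PGH-rigidity of S³×ℝ: LiWang2024 Thm 1.1); an unclassified non-compact 4-d shrinker — BCCD 2024 (density never computed) or a non-Kähler conical one — may have Θ ∈ (.791, 1).
sources: CaoHamiltonIlmanen2004, LiWang2024, LiWang2020, LiWang2019, Yokota2009, CarrilloNi2009
[crux] (card G-ends, sharpened) the round cylinder maximises the Gaussian density among complete
NON-COMPACT non-flat 4-dimensional gradient shrinking Ricci solitons: for (M⁴, g, f) connected,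
non-compact, complete (closed g-balls compact), Ric + Hess f = g/2, normalised by R + |∇f|² = f, and
R ≢ 0, one has (4π)⁻² ∫_M e^{−f} dV ≤ Θ(S³×ℝ) = 2√π e^{−3/2} ≈ .791, i.e. ∫ e^{−f} dV ≤ 32π²√π
e^{−3/2} ≈ 124.9 (by CarrilloNi2009 / LiWang2019 (2.5) the left side is e^{μ(g,1)} = CHI's central
density; equality for S³×ℝ, S³/Γ×ℝ give .791/|Γ|, S²×ℝ² .736, FIK .672). Typed (rev 1, cone repair)
over the fact-free vocabulary: dV = `riemannianMeasure (g.toContMDiffRiemannianMetric hg)`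
(Volume.lean; = `g.riemVolume`, `riemVolume_eq hg`), closed balls of `g.edist hg`
(RiemannianDistance.lean; = `g.riemEDist`, `riemEDist_eq hg`) compact; the two soliton clauses are
`g.IsNormalisedShrinker f 1` unfolded (GradientShrinker.lean, `isNormalisedShrinker_one_iff`) and
the conclusion is `g.shrinkerDensity f 1 ≤ Θ(S³×ℝ)` unfolded (`shrinkerDensity_def`). Same
proposition as rev 0 (stmt-SmoothPoincare4-6808) with `riemVolume`/`riemEDist` unfolded one step.
[difficulty: open-problem] -/
@[route_item "route-SmoothPoincare4-EntropyRung", crux]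
def NoncompactShrinkerGap : Prop :=
  ∀ (M : Type) [TopologicalSpace M] [T2Space M] [SecondCountableTopology M] [ChartedSpace (EuclideanSpace ℝ (Fin 4)) M] [IsManifold (𝓡 4) ∞ M] [ConnectedSpace M] [NoncompactSpace M] [T3Space M] [MeasurableSpace M] [BorelSpace M] (g : Literature.Geometry.Lorentzian.PseudoRiemannianMetric (𝓡 4) ∞ (EuclideanSpace ℝ (Fin 4)) (TangentSpace (𝓡 4) : M → Type _)) [g.HasLeviCivita] (f : M → ℝ) (hg : g.IsRiemannian), (∀ (x : M) (r : NNReal), IsCompact {y : M | g.edist hg x y ≤ r}) → ContMDiff (𝓡 4) 𝓘(ℝ, ℝ) ∞ f → (∀ (x : M) (X Y : TangentSpace (𝓡 4) x), g.ricci x X Y + g.hessian f x X Y = (1 / 2 : ℝ) * g.val x X Y) → (∀ x : M, g.scalarCurvature x + g.gradSq f x = f x) → (∃ x : M, g.scalarCurvature x ≠ 0) → ∫⁻ x, ENNReal.ofReal (Real.exp (-f x)) ∂(Literature.Geometry.Lorentzian.riemannianMeasure (g.toContMDiffRiemannianMetric hg)) ≤ ENNReal.ofReal (32 * Real.pi ^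 2 * Real.sqrt Real.pi * Real.exp (-(3 : ℝ) / 2))

-- earlier SubcylindricalRecognition (stmt-SmoothPoincare4-6809, replaced 2026-08-15T16:25:34Z -> stmt-SmoothPoincare4-10869): retired by None — ∀ (M : Type) [TopologicalSpace M] [T2Space M] [SecondCountableTopology M] [ChartedSpace (EuclideanSpace ℝ (Fin 4)) M] [IsManifold (𝓡 4) ∞ M] [CompactSpace M] [T3Space M] [MeasurableSpace M] [BorelSpace M], M ≃ₕ Metric.sphere (0 : EuclideanSpace ℝ (Fin 5)) 1 
/-- item stmt-SmoothPoincare4-10869 · crux · rank 3 · open · by planner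
why it might fail: Proof = Perelman monotonicity + Bamler's singular-time tangent flows (2009.03243 §2.6/§2.10) + BOTH density gaps + orbifold shrinkers have Θ ≤ 1/2; one non-round (orbifold) 4-d shrinker with Θ ∈ (.791, 1) kills it as stated, and none of Bamler's package is in the library.
sources: Perelman2002Entropy, CaoHamiltonIlmanen2004, Bamler2020Structure, Bamler2023, Bamler2020Entropy, LiWang2019
[crux] (card RUNG) for a closed smooth 4-manifold M ≃ₕ S⁴ and a Riemannian metric g with Levi-Civita
connection, if scal_g > 0 everywhere and ν(g) > ν_cyl — typed: ∃ δ > 0 ∀ τ > 0 ∀ f smooth with ∫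
(4πτ)^{−4/2} e^{−f} dV = 1, log 2 + ½ log π − 3/2 + δ ≤ 𝒲(g,f,τ) = ∫ [τ(R + |∇f|²) + f − 4]
(4πτ)^{−4/2} e^{−f} dV, dV = `riemannianMeasure (g.toContMDiffRiemannianMetric hg)`, which is
literally `(ν_cyl + δ : EReal) ≤ g.muEntropy g.leviCivita τ` of PerelmanEntropy.lean unfolded
(`le_muEntropy_iff`, `riemVolume_eq hg`, `scalarCurvatureWith_leviCivita` rfl,
`finrank_euclideanSpace_fin`) — then M is diffeomorphic to S⁴. Intended proof: R > 0 ⇒ singular time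
T ≤ 2/R_min (in tree); μ-monotonicity ⇒ every tangent flow at (x,T), x in Bamler's singular slice
M_T, is a non-flat orbifold gradient shrinker with log Θ = 𝒩_{x,T}(0) ≥ ν(g) > ν_cyl;
NoncompactShrinkerGap + (orbifold points force Θ ≤ 1/2) + CompactShrinkerGap leave only a compact
model diffeomorphic to S⁴, and a compact smooth tangent flow N of a flow on connected closed M gives
M ≅ N. Same proposition as rev 0 (stmt-SmoothPoincare4-6809) with μ unfolded. [deps:
NoncompactShrinkerGap, CompactShrinkerGap] [difficulty: XL] -/
@[route_item "route-SmoothPoincare4-EntropyRung", crux]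
def SubcylindricalRecognition : Prop :=
  ∀ (M : Type) [TopologicalSpace M] [T2Space M] [SecondCountableTopology M] [ChartedSpace (EuclideanSpace ℝ (Fin 4)) M] [IsManifold (𝓡 4) ∞ M] [CompactSpace M] [T3Space M] [MeasurableSpace M] [BorelSpace M], M ≃ₕ Metric.sphere (0 : EuclideanSpace ℝ (Fin 5)) 1 → ∀ (g : Literature.Geometry.Lorentzian.PseudoRiemannianMetric (𝓡 4) ∞ (EuclideanSpace ℝ (Fin 4)) (TangentSpace (𝓡 4) : M → Type _)) [g.HasLeviCivita] (hg : g.IsRiemannian), (∀ x : M, 0 < g.scalarCurvature x) → (∃ δ : ℝ, 0 < δ ∧ ∀ τ : ℝ, 0 < τ → ∀ f : M → ℝ, ContMDiff (𝓡 4) 𝓘(ℝ, ℝ) ∞ f → ∫ x, (4 * Real.pi * τ) ^ (-(4 : ℝ) / 2) * Real.exp (-f x) ∂(Literature.Geometry.Lorentzian.riemannianMeasure (g.toContMDiffRiemannianMetric hg)) = 1 → Real.log 2 + Real.log Real.pi / 2 - 3 / 2 + δ ≤ ∫ x, (τ * (g.scalarCurvature x + g.gradSq f x) + f x - 4) * ((4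 * Real.pi * τ) ^ (-(4 : ℝ) / 2) * Real.exp (-f x)) ∂(Literature.Geometry.Lorentzian.riemannianMeasure (g.toContMDiffRiemannianMetric hg))) → Nonempty (M ≃ₘ⟮𝓡 4, 𝓡 4⟯ (Metric.sphere (0 : EuclideanSpace ℝ (Fin 5)) 1))

-- earlier CompactShrinkerGap (stmt-SmoothPoincare4-6810, replaced 2026-08-15T16:25:34Z -> stmt-SmoothPoincare4-10870): retired by None — ∀ (M : Type) [TopologicalSpace M] [T2Space M] [SecondCountableTopology M] [ChartedSpace (EuclideanSpace ℝ (Fin 4)) M] [IsManifold (𝓡 4) ∞ M] [CompactSpace M] [T3Space M] [MeasurableSpace M] [BorelSpace M], M ≃ₕ Metric.sphere (0 : EuclideanSpace ℝ (Fin 5)) 1 → ∀ (g 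
/-- item stmt-SmoothPoincare4-10870 · crux · rank 4 · open · by planner
why it might fail: Einstein case is closed (Hitchin1974: W⁺≡0 ⇒ round; Gursky2000: else Vol ≤ Vol(S⁴)/3, Θ ≤ .271), but compact NON-Einstein 4-d shrinkers with b₂ = 0 are unclassified — none known, no theorem excludes one of density > .791 on an exotic Σ, where the statement is SPC4-hard.
sources: Hitchin1974, Gursky2000, CaoHamiltonIlmanen2004, ChengZhou2023, LiNiWang2016, HaslhoferMuller2011
[crux] (card G-compact, restricted to what the rung needs) a closed smooth 4-manifold M ≃ₕ S⁴
carrying a gradient shrinking soliton structure (g, f), Ric + Hess f = g/2, R + |∇f|² = f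
(`g.IsNormalisedShrinker f 1` unfolded), of Gaussian density (4π)⁻² ∫ e^{−f} dV > Θ(S³×ℝ), typed as
32π²√π e^{−3/2} < ∫ e^{−f} dV with dV = `riemannianMeasure (g.toContMDiffRiemannianMetric hg)` (=
`g.riemVolume`, `riemVolume_eq hg`; i.e. `g.shrinkerDensity f 1 > Θ_cyl` unfolded), is diffeomorphic
to S⁴. Einstein sub-case (f constant): W⁺ ≡ 0 forces W ≡ 0 (σ = 0) hence constant curvature
(Hitchin1974) hence S⁴ (Kuiper, in tree); W^± ≢ 0 forces ∫|W^±|² ≥ ∫R²/24 each (Gursky2000), so with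
χ = 2, Vol ≤ Vol(S⁴)/3 and Θ ≤ 2/e² = .271 < .791. Live part: non-Einstein compact shrinkers on
homotopy spheres. Same proposition as rev 0 (stmt-SmoothPoincare4-6810) with `riemVolume` unfolded.
[difficulty: L] -/
@[route_item "route-SmoothPoincare4-EntropyRung", crux]
def CompactShrinkerGap : Prop :=
  ∀ (M : Type) [TopologicalSpace M] [T2Space M] [SecondCountableTopology M] [ChartedSpace (EuclideanSpace ℝ (Fin 4)) M] [IsManifold (𝓡 4) ∞ M] [CompactSpace M] [T3Space M] [MeasurableSpace M] [BorelSpace M], M ≃ₕ Metric.sphere (0 : EuclideanSpace ℝ (Fin 5)) 1 → ∀ (g : Literature.Geometry.Lorentzian.PseudoRiemannianMetric (𝓡 4) ∞ (EuclideanSpace ℝ (Fin 4)) (TangentSpace (𝓡 4) : M → Type _)) [g.HasLeviCivita] (f : M → ℝ) (hg : g.IsRiemannian), ContMDiff (𝓡 4) 𝓘(ℝ, ℝ) ∞ f → (∀ (x : M) (X Y : TangentSpace (𝓡 4) x), g.ricci x X Y + g.hessian f x X Y = (1 / 2 : ℝ) * g.val x X Y) → (∀ x : M, g.scalarCurvature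 x + g.gradSq f x = f x) → ENNReal.ofReal (32 * Real.pi ^ 2 * Real.sqrt Real.pi * Real.exp (-(3 : ℝ) / 2)) < ∫⁻ x, ENNReal.ofReal (Real.exp (-f x)) ∂(Literature.Geometry.Lorentzian.riemannianMeasure (g.toContMDiffRiemannianMetric hg)) → Nonempty (M ≃ₘ⟮𝓡 4, 𝓡 4⟯ (Metric.sphere (0 : EuclideanSpace ℝ (Fin 5)) 1))

-- earlier SubcylindricalExistence (stmt-SmoothPoincare4-6811, replaced 2026-08-15T16:25:34Z -> stmt-SmoothPoincare4-10871): retired by None — ∀ (M : Type) [TopologicalSpace M] [T2Space M] [SecondCountableTopology M] [ChartedSpace (EuclideanSpace ℝ (Fin 4)) M] [IsManifold (𝓡 4) ∞ M] [CompactSpace M] [T3Space M] [MeasurableSpace M] [BorelSpace M], M ≃ₕ Metric.sphere (0 : EuclideanSpace ℝ (Fin 5)) 1 → 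
/-- item stmt-SmoothPoincare4-10871 · crux · rank 5 · open · by planner
why it might fail: ⇔ SPC4 given the rung, so false iff an exotic S⁴ exists; as a programme: ν is not monotone under the codim-2/3 regluings producing Σ from S⁴ (neck-stretching drives ν below ν_cyl), so no construction of a super-cylindrical metric is known on a Σ not already identified with S⁴.
sources: Perelman2002Entropy, CaoHamiltonIlmanen2004, Topping2006, Bamler2021Notices, CarrilloNi2009
[crux] (card ENT) every closed smooth 4-manifold M ≃ₕ S⁴ carries a Riemannian metric g (with
Levi-Civita connection) with scal_g > 0 and ν(g) > ν_cyl, typed exactly as the hypotheses of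
SubcylindricalRecognition: ∃ g, ∃ [g.HasLeviCivita], ∃ hg : g.IsRiemannian, (∀ x, 0 < scal_g x) ∧ ∃
δ > 0 ∀ τ > 0 ∀ f smooth with ∫ (4πτ)^{−4/2} e^{−f} dV = 1, log 2 + ½ log π − 3/2 + δ ≤ ∫ [τ(R +
|∇f|²) + f − 4] (4πτ)^{−4/2} e^{−f} dV, dV = `riemannianMeasure (g.toContMDiffRiemannianMetric hg)`
(= μ(g,τ) ≥ ν_cyl + δ unfolded: `le_muEntropy_iff`, `riemVolume_eq hg`). True on S⁴ (round metric: ν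
= log 6 − 2, δ = 0.026); with the rung it is ⇔ SPC4. Attack (card): maximise ν over {R > 0} —
constrained critical points are shrinkers on Σ — and localise to asymptotically Euclidean metrics on
the punctured Σ° via ν(Σ) ≥ min(ν_rd, ν_AE(Σ°)) − o(1). Same proposition as rev 0
(stmt-SmoothPoincare4-6811) with μ unfolded. [deps: SubcylindricalRecognition] [difficulty:
open-problem] -/
@[route_item "route-SmoothPoincare4-EntropyRung", crux]
def SubcylindricalExistence : Prop :=
  ∀ (M : Type) [TopologicalSpace M] [T2Space M] [SecondCountableTopology M] [ChartedSpace (EuclideanSpace ℝ (Fin 4)) M] [IsManifold (𝓡 4) ∞ M] [CompactSpace M] [T3Space M] [MeasurableSpace M] [BorelSpace M], M ≃ₕ Metric.sphere (0 : EuclideanSpace ℝ (Fin 5)) 1 → ∃ g : Literature.Geometry.Lorentzian.PseudoRiemannianMetric (𝓡 4) ∞ (EuclideanSpace ℝ (Fin 4)) (TangentSpace (𝓡 4) : M → Type _), ∃ _ : g.HasLeviCivita, ∃ hg : g.IsRiemannian, (∀ x : M, 0 < g.scalarCurvature x) ∧ ∃ δ : ℝ, 0 < δ ∧ ∀ τ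 : ℝ, 0 < τ → ∀ f : M → ℝ, ContMDiff (𝓡 4) 𝓘(ℝ, ℝ) ∞ f → ∫ x, (4 * Real.pi * τ) ^ (-(4 : ℝ) / 2) * Real.exp (-f x) ∂(Literature.Geometry.Lorentzian.riemannianMeasure (g.toContMDiffRiemannianMetric hg)) = 1 → Real.log 2 + Real.log Real.pi / 2 - 3 / 2 + δ ≤ ∫ x, (τ * (g.scalarCurvature x + g.gradSq f x) + f x - 4) * ((4 * Real.pi * τ) ^ (-(4 : ℝ) / 2) * Real.exp (-f x)) ∂(Literature.Geometry.Lorentzian.riemannianMeasure (g.toContMDiffRiemannianMetric hg))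

/-- item stmt-SmoothPoincare4-10834 · crux · rank 6 · closed · proved by Summit.SmoothPoincare4.SmoothPoincare4.Theorems.MargerinRails.ChangGurskyYang_weylBudget_proof @ 331fc5878e1d (prover) · by planner
why it might fail: Published theorem (CGY2003 Thm A): false only by a vendoring slip — |W|² (0,4)- vs operator norm (factor 4), 32π² ≤ 16π²χ, C^∞ + Levi-Civita binder (audited, grounded KNOWN on stmt-10834); as a Lean target XL-apex: CGB-4, Margerin1998 (Ricci flow), CGY Thm 1.4 (fully nonlinear PDE) all absent.
sources: ChangGurskyYang2003, arXiv:math/0309287, Margerin1998, Besse1987, Chern1944, LeeParker1987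
[support] NAMED-FACT ITEM — Chang–Gursky–Yang 2003 Thm A, simply connected scal > 0 case, VERBATIM
the text of the Literature named fact `Literature.Geometry.Riemannian.changGurskyYang_sphere_four`
(ChangGurskyYang.lean; deep theorem — fully nonlinear conformal PDE + Margerin's weak pinching —
hence no `_holds`): a compact simply connected Hausdorff second-countable smooth 4-manifold carrying
a C^∞ Riemannian metric (with its Levi-Civita connection) of everywhere positive scalar curvature
and Weyl energy `g.weylEnergy` = ∫|W|² dV < 32π² ((0,4)-norm |W|² = W_ijkl W^ijkl of
WeylEnergy.lean; = 8π² in the End(Λ²)-norm of the thesis,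
`changGurskyYang_sphere_four.of_hamiltonBlocks`) is diffeomorphic to S⁴. It is the recognition step
of the deciding theorem `closes` (WeylLight → ChangGurskyYang → SmoothPoincare4). Inlined rather
than imported so that the route's dependency cone stays fact-free (ChangGurskyYang.lean §Cone
hygiene: 'a route that wants the fact takes it as an explicit hypothesis or inlines its text'); it
closes by `exact h` from any discharge `h : changGurskyYang_sphere_four`. NOT a prover task.
needs-fact: Literature.Geometry.Riemannian.changGurskyYang_sphere_four. [difficu -/
@[route_item "route-SmoothPoincare4-EntropyRung", crux]
def ChangGurskyYang : Prop :=
  ∀ (M : Type) [TopologicalSpace M] [T2Space M] [SecondCountableTopology M] [ChartedSpace (EuclideanSpace ℝ (Fin 4)) M] [IsManifold (𝓡 4) ∞ M] [CompactSpace M] [SimplyConnectedSpace M], (∃ g : Literature.Geometry.Lorentzian.PseudoRiemannianMetric (𝓡 4) ∞ (EuclideanSpace ℝ (Fin 4)) (TangentSpace (𝓡 4) : M → Type _), ∃ _ : g.HasLeviCivita, g.IsRiemannian ∧ (∀ x, 0 < g.scalarCurvature x) ∧ g.weylEnergy < ENNReal.ofReal (32 * Real.pi ^ 2)) → Nonempty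 (M ≃ₘ⟮𝓡 4, 𝓡 4⟯ Metric.sphere (0 : EuclideanSpace ℝ (Fin 5)) 1)

/-- item stmt-SmoothPoincare4-16588 · crux · rank 7 · open · by planner
why it might fail: Published chain (MW15 Thm 1, EMT11 Thm 1.4, Naber10 Lemma 4.1, BB25 Thm 1.8), audited correctly stated: false only by a vendoring slip in the (1±η)-transplant export; XL-apex as a Lean target — CGH compactness, κ-noncollapsing, reduced volume at the singular time, pseudolocality all absent.
sources: MunteanuWang2015, EndersMullerTopping2010, Naber2010, BertellottiBuzano2025, arXiv:2508.10790, HaslhoferMuller2011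
[crux] NAMED-FACT ITEM (route-choice 4ca5ef13: PROMOTED to a crux of route EntropyRung from the
XL-apex Literature fact whose fact-lane split child was reviewed twice without landing) — VERBATIM
the text of `Literature.Geometry.Riemannian.shrinkerSplittingAtInfinity_four`
(ShrinkerSplittingAtInfinity.lean; `Iff.rfl`, kernel-checked in the repair planner's Sketch.lean):
SPLITTING AT INFINITY of a complete connected non-compact non-flat normalised 4-d gradient shrinking
Ricci soliton (Ric + Hess f = g/2, R + |∇f|² = f, R ≢ 0) whose scalar curvature is BOUNDED and does
NOT decay at infinity (∃ ε > 0, every compact set misses a point with R ≥ ε): there are a complete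
connected non-flat normalised 3-d gradient shrinker (N, h, φ) — the factor of the non-flat limit
shrinker X = N × ℝ, f_X = φ + (t−t₀)²/4, of the blow-ups at a Type-I singular point of the soliton's
own Ricci flow — and, for every R₀ and η > 0, an open U ⊇ {φ < R₀} × (−R₀, R₀) in N × ℝ and maps Φ :
N × ℝ → M (smooth on U, open image), Ψ : M → N × ℝ (smooth on Φ(U), Ψ ∘ Φ = id on U) with
(1−η)(h(v,v) + s²) ≤ g(dΦ(v,s), dΦ(v,s)) ≤ (1+η)(h(v,v) + s²) and |R_g(Φ p) − R_h(p.1)| ≤ η on U.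
PRINTED CHAIN: Munteanu–Wang 2015 Thm 1 ( -/
@[route_item "route-SmoothPoincare4-EntropyRung", crux]
def ShrinkerSplittingAtInfinity : Prop :=
  ∀ (M : Type) [TopologicalSpace M] [T2Space M] [SecondCountableTopology M] [ChartedSpace (EuclideanSpace ℝ (Fin 4)) M] [IsManifold (𝓡 4) ∞ M] [ConnectedSpace M] [NoncompactSpace M] [T3Space M] [MeasurableSpace M] [BorelSpace M] (g : Literature.Geometry.Lorentzian.PseudoRiemannianMetric (𝓡 4) ∞ (EuclideanSpace ℝ (Fin 4)) (TangentSpace (𝓡 4) : M → Type _)) [g.HasLeviCivita] (f : M → ℝ) (hg : g.IsRiemannian), (∀ (x : M) (r : NNReal), IsCompact {y : M | g.edist hg x y ≤ r}) → ContMDiff (𝓡 4) 𝓘(ℝ, ℝ) ∞ f → (∀ (x : M) (X Y : TangentSpace (𝓡 4) x), g.ricci x X Y + g.hessian f x X Y = (1 / 2 : ℝ) * g.val x X Y) → (∀ x : M, g.scalarCurvature x + g.gradSq f x = f x) → (∃ x : M, g.scalarCurvature x ≠ 0) → (∃ C : ℝ, ∀ x : M, g.scalarCurvature x ≤ C) →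 (∃ ε : ℝ, 0 < ε ∧ ∀ K : Set M, IsCompact K → ∃ x, x ∉ K ∧ ε ≤ g.scalarCurvature x) → ∃ (N : Type) (_ : TopologicalSpace N) (_ : T2Space N) (_ : SecondCountableTopology N) (_ : ChartedSpace (EuclideanSpace ℝ (Fin 3)) N) (_ : IsManifold (𝓡 3) ∞ N) (_ : ConnectedSpace N) (_ : T3Space N) (_ : MeasurableSpace N) (_ : BorelSpace N) (h : Literature.Geometry.Lorentzian.PseudoRiemannianMetric (𝓡 3) ∞ (EuclideanSpace ℝ (Fin 3)) (TangentSpace (𝓡 3) : N → Type _)) (_ : h.HasLeviCivita) (φ : N → ℝ) (hh : h.IsRiemannian), (∀ (y : N) (r : NNReal), IsCompact {z : N | h.edist hh y z ≤ r}) ∧ ContMDiff (𝓡 3) 𝓘(ℝ, ℝ) ∞ φ ∧ (∀ (y : N) (X Y : TangentSpace (𝓡 3) y), h.ricci y X Y + h.hessian φ y X Y = (1 / 2 : ℝ) * h.val y X Y) ∧ (∀ y : N, h.scalarCurvature y + h.gradSq φ y = φ y) ∧ (∃ y : N, h.scalarCurvature y ≠ 0) ∧ (∀ R η : ℝ, 0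 < η → ∃ (U : Set (N × ℝ)) (Φ : N × ℝ → M) (Ψ : M → N × ℝ), IsOpen U ∧ {y : N | φ y < R} ×ˢ Set.Ioo (-R) R ⊆ U ∧ ContMDiffOn ((𝓡 3).prod 𝓘(ℝ, ℝ)) (𝓡 4) ∞ Φ U ∧ IsOpen (Φ '' U) ∧ ContMDiffOn (𝓡 4) ((𝓡 3).prod 𝓘(ℝ, ℝ)) ∞ Ψ (Φ '' U) ∧ (∀ p ∈ U, Ψ (Φ p) = p) ∧ (∀ p ∈ U, ∀ (v : EuclideanSpace ℝ (Fin 3)) (s : ℝ), (1 - η) * (h.val p.1 v v + s ^ 2) ≤ g.val (Φ p) (mfderiv ((𝓡 3).prod 𝓘(ℝ, ℝ)) (𝓡 4) Φ p (v, s)) (mfderiv ((𝓡 3).prod 𝓘(ℝ, ℝ)) (𝓡 4) Φ p (v, s)) ∧ g.val (Φ p) (mfderiv ((𝓡 3).prod 𝓘(ℝ, ℝ)) (𝓡 4) Φ p (v, s)) (mfderiv ((𝓡 3).prod 𝓘(ℝ, ℝ)) (𝓡 4) Φ p (v, s)) ≤ (1 + η) * (h.val p.1 v v + s ^ 2)) ∧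 (∀ p ∈ U, |g.scalarCurvature (Φ p) - h.scalarCurvature p.1| ≤ η))

/-- item stmt-SmoothPoincare4-16589 · crux · rank 8 · open · by planner
why it might fail: A non-Kähler asymptotically conical 4-d shrinker with Θ ∈ (.791, 1) refutes it: only the Kähler class is classified (Li–Wang 2023; densities ≤ .736 by Duistermaat–Heckman) and no entropy or AVR bound below 1 is known on the non-Kähler conical class.
sources: MunteanuWang2019, ConlonDeruelleSun2024, arXiv:2301.09784, KotschwarWang2015, BamlerEtAl2024, FeldmanIlmanenKnopf2003
[crux] RESIDUE 1 of NoncompactShrinkerGap (route-choice 4ca5ef13, filed top-level with the glue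
support NoncompactGapReduction; = registered stub `stub_conicalGap` of line collapsed-ends-usc
VERBATIM, E4 expanded; leads c0–c5 + the standing disprover: the recognised OPEN CORE): the density
gap ∫e^{−f}dV ≤ 32π²√π e^{−3/2} (Θ ≤ .791) for complete connected non-compact non-flat normalised
4-d gradient shrinkers whose scalar curvature tends to 0 at infinity (∀ ε > 0 ∃ K compact, R < ε off
K) — by Munteanu–Wang (MW15 |Rm| ≤ cR, MW19 Thm 1.4; Conlon–Deruelle–Sun) exactly the ASYMPTOTICALLY
CONICAL shrinkers, Kotschwar–Wang-rigid given the cone. Settled sub-classes: Kähler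
(arXiv:2301.09784 Thm 1.1 classification {ℂ², FIK, ℙ¹×ℂ, BCCD} + Duistermaat–Heckman densities: FIK
.672, ℙ¹×ℂ .736, BCCD .5617 closed form — Cruxes/NoncompactShrinkerGap/Disproof.lean §2, §10,
`bccdClosedFormBound_lt_cylinderDensity`); cohomogeneity-one families on ℝ⁴, O(−k), ℝ×S³, ℝ²×S²
scanned empty (Disproof §8). Live content: NON-Kähler asymptotically conical 4-d shrinkers — none
known; cohomogeneity-two U(1)×U(1) family unscanned (disprover-wanted numerics); Disproof §6: the
crux ⇔-neighbourhood is AVR (Θ ≥ .4232· -/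
@[route_item "route-SmoothPoincare4-EntropyRung", crux]
def ConicalGap : Prop :=
  ∀ (M : Type) [TopologicalSpace M] [T2Space M] [SecondCountableTopology M] [ChartedSpace (EuclideanSpace ℝ (Fin 4)) M] [IsManifold (𝓡 4) ∞ M] [ConnectedSpace M] [NoncompactSpace M] [T3Space M] [MeasurableSpace M] [BorelSpace M] (g : Literature.Geometry.Lorentzian.PseudoRiemannianMetric (𝓡 4) ∞ (EuclideanSpace ℝ (Fin 4)) (TangentSpace (𝓡 4) : M → Type _)) [g.HasLeviCivita] (f : M → ℝ) (hg : g.IsRiemannian), (∀ (x : M) (r : NNReal), IsCompact {y : M | g.edist hg x y ≤ r}) → ContMDiff (𝓡 4) 𝓘(ℝ, ℝ) ∞ f → (∀ (x : M) (X Y : TangentSpace (𝓡 4) x), g.ricci x X Y + g.hessian f x X Y = (1 / 2 : ℝ) * g.val x X Y) → (∀ x : M, g.scalarCurvature x + g.gradSq f x = f x) → (∃ x : M, g.scalarCurvature x ≠ 0) → (∀ ε : ℝ, 0 < ε → ∃ K : Set M, IsCompact K ∧ ∀ x, x ∉ K → g.scalarCurvature x < ε) → ∫⁻ x, ENNReal.ofReal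 (Real.exp (-f x)) ∂(Literature.Geometry.Lorentzian.riemannianMeasure (g.toContMDiffRiemannianMetric hg)) ≤ ENNReal.ofReal (32 * Real.pi ^ 2 * Real.sqrt Real.pi * Real.exp (-(3 : ℝ) / 2))

/-- item stmt-SmoothPoincare4-14742 · support · rank 9 · open · by planner
why it might fail: Only via its inputs: an ORBIFOLD tangent flow with Θ ∈ (.791, 1) evading the cone-point test (−log|Γ| ≤ −log 2 < ν_cyl is certified), or Bamler 2020abc / Perelman (T2) mis-vendored as named facts; as mathematics it is Perelman + Bamler, published.
sources: Perelman2002Entropy, Bamler2020Entropy, Bamler2023, Bamler2020Structure, arXiv:2009.03243, CaoHamiltonIlmanen2004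
[support] GLUE (rev 3, route-repair unused-crux): the two shrinker density gaps imply the rung —
NoncompactShrinkerGap → CompactShrinkerGap → SubcylindricalRecognition. This is the Perelman–Bamler
reduction named in the thesis (TWO-LAYER PLAN: DensityFloor → ModelGap → CompactModel, collapsed
into one implication over the route's own decls): for closed M ≃ₕ S⁴ with R > 0 and ν(g) > ν_cyl,
short-time existence + Perelman's μ-monotonicity give a Ricci flow singular at T ≤ 2/R_min whose
blow-up sequence at points of almost-maximal curvature has a blow-down (Bamler 2020a Prop. 5.2 `𝒩 ≥
μ`, Thm. 10.1 ε-regularity; 2020b compactness; 2020c Thms. 4, 9, 15, 29, 35) that is a complete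
non-flat gradient shrinker (S, g_S, f_S), Ric + Hess f = g/2, R + |∇f|² = f, of Gaussian mass ∫
e^{−f} dV_S > 32π²√π e^{−3/2} (the entropy floor passes to the limit; an orbifold cone point of
order |Γ| ≥ 2 on the limit would force μ(λg_k(t), τ) ≤ −log|Γ| + o(1) < ν_cyl + δ on the compact
approximants — certified margin `half_lt_thetaCyl` — so S is smooth); S non-compact contradicts
NoncompactShrinkerGap; S compact immerses injectively into the connected M, hence S ≅ M ≃ₕ S⁴ and
CompactShrinkerGap returns S ≅ S -/
@[route_item "route-SmoothPoincare4-EntropyRung"]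
def RecognitionOfShrinkerGaps : Prop :=
  NoncompactShrinkerGap → CompactShrinkerGap → SubcylindricalRecognition

/-- item stmt-SmoothPoincare4-14743 · support · rank 9 · open · by planner
why it might fail: A compact NON-Einstein shrinker on a homotopy 4-sphere with density > .791 but ∫|W|² ≥ 32π² (⟺ ∫(R−2)² ≥ 2Vol − 96π²) shuts the CGY door; compact b₂ = 0 shrinkers are unclassified (no non-round one known: Kotschwar 2008, Donovan 2025 Conj. 1.5).
sources: ChangGurskyYang2003, CaoHamiltonIlmanen2004, ChengRibeiroZhou2022, Hitchin1974, Gursky2000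
[support] GLUE (rev 3, route-repair unused-crux): the Chang–Gursky–Yang recogniser implies the
compact density gap — ChangGurskyYang → CompactShrinkerGap (ChangGurskyYang = crux rank 6,
stmt-10834, the NAMED-FACT ITEM verbatim
`Literature.Geometry.Riemannian.changGurskyYang_sphere_four`, shared with route WeylBudget).
Content: for a closed M ≃ₕ S⁴ with a normalised gradient shrinker (g, f), Ric + Hess f = g/2, R +
|∇f|² = f, of Gaussian mass ∫ e^{−f} dV > 32π²√π e^{−3/2} (density > Θ(S³×ℝ) = .791): (i) R > 0
everywhere (closed non-flat shrinker; LANDED p71988 `stub_scalarCurvaturePos_of_identities` from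
p71473), (ii) π₁(M) = 1 (M ≃ₕ S⁴, proved in
Literature/Topology/FourManifolds/HomotopyS4SimplyConnected), (iii) the WEYL BUDGET `g.weylEnergy` =
∫|W|² dV < 32π² = 16π²χ ((0,4)-norm of WeylEnergy.lean) — the one OPEN stub `stub_weylBudget` of the
picked line Cruxes/CompactShrinkerGap/Lines/cgy-variance-pivot.lean (v8, rc 0; equivalently, modulo
the named fact `chernGaussBonnet_four` with χ = 2 and the landed ∫σ₂ = V/6 − D/12, the variance
budget ∫(R − 2)² dV < 2·Vol − 96π², `weylBudget_iff_varianceBudget`; margin 96π² at the round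
shrinker S⁴(√6); the Einstein sub-case and R ≤ 2.48 a -/
@[route_item "route-SmoothPoincare4-EntropyRung"]
def CompactGapOfChangGurskyYang : Prop :=
  ChangGurskyYang → CompactShrinkerGap

/-- item stmt-SmoothPoincare4-16586 · support · rank 9 · closed · proved by Summit.SmoothPoincare4.SmoothPoincare4.Theorems.ThreeShrinkerGap.threeShrinkerGap_proof @ 829bb1f09ce2 (prover) · by planner
why it might fail: Known (corollary of the 3-d shrinker classification, Cao–Chen–Zhu 2008 / Munteanu–Wang 2019 Thm 1.2): false only by a slip in the four model constants, re-derived by lead c5; proved in tree modulo threeShrinkerClassification_modelData (p87530).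
sources: MunteanuWang2019, CaoHamiltonIlmanen2004, CarrilloNi2009, Literature.Geometry.Riemannian.threeShrinkerClassification_modelData
[support] THE RUNG ONE DIMENSION DOWN (route-choice 4ca5ef13; = def `ThreeShrinkerGap` of line
collapsed-ends-usc of crux NoncompactShrinkerGap, skeleton v11 ll. 209–229, VERBATIM with E3
expanded): every complete connected non-flat normalised 3-d gradient shrinking Ricci soliton (Ric +
Hess φ = h/2, R + |∇φ|² = φ, R ≢ 0; compact allowed) has ∫ e^{−φ} dV ≤ 16π² e^{−3/2} = (4π)^{3/2}
Θ₃(S³) (S³/Γ: 16π²e^{−3/2}/|Γ|, equality iff Γ = 1; S²(√2)×ℝ: 16π√π e^{−1}, ratio e^{1/2}/√π = .930;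
its ℤ₂ quotient half of that). KNOWN: a corollary of the classification of complete 3-d shrinkers
(Cao–Chen–Zhu 2008; Munteanu–Wang 2019 Thm 1.2 as stated) — PROVED in the tree MODULO that
classification: `stub_threeShrinkerGap_of_classification : threeShrinkerClassification_modelData →
<this statement>` (Theorems/EntropyRungNoncompactShrinkerGapStubThreeShrinkerGap.lean, p87530; four
model constants re-derived by lead c5 of stmt-SmoothPoincare4-10868), so this item closes by ONE
LINE the moment `threeShrinkerClassification_modelData_holds` lands (literature seat in flight:
compact case `ThreeShrinker.modelData_of_compactSpace`, scalar-flat and degenerate non-compact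
branches landed 2026-08-16; missing i -/
@[route_item "route-SmoothPoincare4-EntropyRung", crux]
def ThreeShrinkerGap : Prop :=
  ∀ (N : Type) [TopologicalSpace N] [T2Space N] [SecondCountableTopology N] [ChartedSpace (EuclideanSpace ℝ (Fin 3)) N] [IsManifold (𝓡 3) ∞ N] [ConnectedSpace N] [T3Space N] [MeasurableSpace N] [BorelSpace N] (h : Literature.Geometry.Lorentzian.PseudoRiemannianMetric (𝓡 3) ∞ (EuclideanSpace ℝ (Fin 3)) (TangentSpace (𝓡 3) : N → Type _)) [h.HasLeviCivita] (φ : N → ℝ) (hh : h.IsRiemannian), (∀ (x : N) (r : NNReal), IsCompact {y : N | h.edist hh x y ≤ r}) → ContMDiff (𝓡 3) 𝓘(ℝ, ℝ) ∞ φ → (∀ (x : N) (X Y : TangentSpace (𝓡 3) x), h.ricci x X Y + h.hessian φ x X Y = (1 / 2 : ℝ) * h.val x X Y) → (∀ x : N, h.scalarCurvature x + h.gradSq φ x = φ x) → (∃ x : N, h.scalarCurvature x ≠ 0) → ∫⁻ x, ENNReal.ofReal (Real.exp (-φ x)) ∂(Literature.Geometry.Lorentzian.riemannianMeasure (h.toContMDiffRiemannianMetric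 hh)) ≤ ENNReal.ofReal (16 * Real.pi ^ 2 * Real.exp (-(3 : ℝ) / 2))

/-- item stmt-SmoothPoincare4-16587 · support · rank 9 · closed · proved by Summit.SmoothPoincare4.SmoothPoincare4.Theorems.BakryEmeryComplete.bakryEmeryLogSobolev_proof @ aecc2b319cb2 (prover) · by planner
why it might fail: Textbook theorem (Bakry–Émery 1985; Carrillo–Ni 2009 Thm 3.1; BGL 2014 Prop 5.7.1): false only by a vendoring slip (P₂ and finite-Fisher provisos present); XL as a Lean target (no heat semigroup on complete weighted manifolds).
sources: CarrilloNi2009, BakryGentilLedoux2014, BakryEmery1985, Literature.Geometry.Riemannian.bakryEmery_logSobolev_complete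
[support] NAMED-FACT ITEM (route-choice 4ca5ef13) — the TEXTBOOK Bakry–Émery logarithmic Sobolev
inequality of a complete CD(K,∞) weighted Riemannian manifold, K > 0 (Bakry–Émery 1985; Carrillo–Ni
2009 Thm 3.1, p. 7; Bakry–Gentil–Ledoux 2014 Prop 5.7.1 + the weighted-manifold remark after Cor
5.7.2, p. 268): for M connected modelled on ℝⁿ, g a complete C^∞ Riemannian metric (closed
g.edist-balls compact) with its Levi-Civita connection, V smooth with K g ≤ Ric + Hess V on the
diagonal, K > 0, ∫ e^{−V} dV_g = 1, and every smooth φ with ∫ e^{φ}e^{−V} dV_g = 1, bounded second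
moment and integrable Fisher integrand: ∫ φ e^{φ}e^{−V} dV_g ≤ (2K)⁻¹ ∫ |∇φ|²_g e^{φ}e^{−V} dV_g.
This is the text of the Literature named fact
`Literature.Geometry.Riemannian.bakryEmery_logSobolev_complete` (BakryEmeryLogSobolev.lean, p116121;
junk-value audit in its module docstring) with `g.riemVolume` / `g.riemEDist` unfolded ONE STEP to
the route's fact-free vocabulary (riemannianMeasure (g.toContMDiffRiemannianMetric hg), g.edist hg)
so that the route file's import cone stays fact-free; it is EQUIVALENT to the fact by `riemVolume_eq
hg` / `riemEDist_eq hg` (both directions kernel-checked in the repair plann -/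
@[route_item "route-SmoothPoincare4-EntropyRung"]
def BakryEmeryLogSobolev : Prop :=
  ∀ (n : ℕ) (M : Type) [TopologicalSpace M] [T2Space M] [SecondCountableTopology M] [ChartedSpace (EuclideanSpace ℝ (Fin n)) M] [IsManifold (𝓡 n) ∞ M] [ConnectedSpace M] [T3Space M] [MeasurableSpace M] [BorelSpace M] (g : Literature.Geometry.Lorentzian.PseudoRiemannianMetric (𝓡 n) ∞ (EuclideanSpace ℝ (Fin n)) (TangentSpace (𝓡 n) : M → Type _)) [g.HasLeviCivita] (V : M → ℝ) (K : ℝ) (hg : g.IsRiemannian), (∀ (x : M) (r : NNReal), IsCompact {y : M | g.edist hg x y ≤ r}) → ContMDiff (𝓡 n) 𝓘(ℝ, ℝ) ∞ V → 0 < K → (∀ (x : M) (X : TangentSpace (𝓡 n) x), K * g.val x X X ≤ g.ricci x X X + g.hessian V x X X) → ∫ x, Real.exp (-V x) ∂(Literature.Geometry.Lorentzian.riemannianMeasure (g.toContMDiffRiemannianMetric hg)) = 1 → ∀ φ : M → ℝ, ContMDiff (𝓡 n) 𝓘(ℝ, ℝ) ∞ φ → ∫ x, Real.exp (φ x) * Real.exp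 (-V x) ∂(Literature.Geometry.Lorentzian.riemannianMeasure (g.toContMDiffRiemannianMetric hg)) = 1 → (∃ o : M, Integrable (fun x ↦ (g.edist hg o x).toReal ^ 2 * (Real.exp (φ x) * Real.exp (-V x))) (Literature.Geometry.Lorentzian.riemannianMeasure (g.toContMDiffRiemannianMetric hg))) → Integrable (fun x ↦ g.gradSq φ x * (Real.exp (φ x) * Real.exp (-V x))) (Literature.Geometry.Lorentzian.riemannianMeasure (g.toContMDiffRiemannianMetric hg)) → ∫ x, φ x * (Real.exp (φ x) * Real.exp (-V x)) ∂(Literature.Geometry.Lorentzian.riemannianMeasure (g.toContMDiffRiemannianMetric hg)) ≤ 1 / (2 * K) * ∫ x, g.gradSq φ x * (Real.exp (φ x) * Real.exp (-V x)) ∂(Literature.Geometry.Lorentzian.riemannianMeasure (g.toContMDiffRiemannianMetric hg))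

/-- item stmt-SmoothPoincare4-16590 · support · rank 9 · open · by planner
why it might fail: Nothing bounds the curvature of a complete non-compact 4-d shrinker (CFSZ 2020: quadratic growth only), blow-downs at infinity have no compactness when sup R = ∞, and no printed theorem excludes such a shrinker with Θ ∈ (.791, 1).
sources: arXiv:1903.09181, MunteanuWang2015, BertellottiBuzano2025, ChowKotschwarMunteanu2025, CaoHamiltonIlmanen2004
[support] RESIDUE 2 of NoncompactShrinkerGap (route-choice 4ca5ef13; = registered stub
`stub_unboundedCurvatureGap` VERBATIM, E4 expanded; CRUX-GRADE in content — an OPEN special case of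
the crux — filed as kind support only because the D-0019 cap of 7 top-level cruxes is reached with
ShrinkerSplittingAtInfinity and ConicalGap, and of the three classes at infinity it is the least
informative: no complete shrinker with unbounded curvature is known in any dimension): the same
density gap for complete connected non-compact non-flat normalised 4-d gradient shrinkers with
UNBOUNDED scalar curvature (¬ ∃ C, R ≤ C). No complete shrinker with unbounded curvature is known in
any dimension and no theorem in print controls this class (Chow–Freedman–Shin–Zhang
arXiv:1903.09181: quadratic curvature growth only; MW15: bounded R ⇒ bounded Rm in dimension 4;
Bertellotti–Buzano 2025 Thms 1.6–1.8 need Type-I S along a gradient curve); the wave-1 worker typed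
the one missing step as UnboundedCurvatureBlowdownReduction (sup R = ∞ ⇒ ∫e^{−f} ≤ 8π² ∨ ∃ complete
non-flat normalised 3-d shrinker N with ∫_M e^{−f} ≤ 2√π ∫_N e^{−φ}; evidence
StubUnboundedCurvatureGap-verdicts.md on stmt-SmoothPoincare4-10868 -/
@[route_item "route-SmoothPoincare4-EntropyRung", crux]
def UnboundedCurvatureGap : Prop :=
  ∀ (M : Type) [TopologicalSpace M] [T2Space M] [SecondCountableTopology M] [ChartedSpace (EuclideanSpace ℝ (Fin 4)) M] [IsManifold (𝓡 4) ∞ M] [ConnectedSpace M] [NoncompactSpace M] [T3Space M] [MeasurableSpace M] [BorelSpace M] (g : Literature.Geometry.Lorentzian.PseudoRiemannianMetric (𝓡 4) ∞ (EuclideanSpace ℝ (Fin 4)) (TangentSpace (𝓡 4) : M → Type _)) [g.HasLeviCivita] (f : M → ℝ) (hg : g.IsRiemannian), (∀ (x : M) (r : NNReal), IsCompact {y : M | g.edist hg x y ≤ r}) → ContMDiff (𝓡 4) 𝓘(ℝ, ℝ) ∞ f → (∀ (x : M) (X Y : TangentSpace (𝓡 4) x), g.ricci x X Y + g.hessian f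 x X Y = (1 / 2 : ℝ) * g.val x X Y) → (∀ x : M, g.scalarCurvature x + g.gradSq f x = f x) → (∃ x : M, g.scalarCurvature x ≠ 0) → (¬ ∃ C : ℝ, ∀ x : M, g.scalarCurvature x ≤ C) → ∫⁻ x, ENNReal.ofReal (Real.exp (-f x)) ∂(Literature.Geometry.Lorentzian.riemannianMeasure (g.toContMDiffRiemannianMetric hg)) ≤ ENNReal.ofReal (32 * Real.pi ^ 2 * Real.sqrt Real.pi * Real.exp (-(3 : ℝ) / 2))

/-- item stmt-SmoothPoincare4-16591 · support · rank 9 · closed · proved by Summit.SmoothPoincare4.SmoothPoincare4.Theorems.noncompactGapReduction_proof @ e78c0458752c (prover) · by planner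
why it might fail: It cannot: kernel-checked already in the repair planner's Sketch.lean against the current tree (composition of the landed Textbook lever p116509, the rung and the trichotomy).
sources: BernsteinWang2016, MunteanuWang2019, CarrilloNi2009
[support] GLUE, PROVABLE NOW (route-choice 4ca5ef13; the repair planner's Sketch.lean proves it
against the current tree, rc 0, 0 sorry — `noncompactGapReduction_provable`, attached as evidence):
THE WHOLE collapsed-ends-usc REDUCTION OF THE CRUX OVER ITEMS — ThreeShrinkerGap →
ShrinkerSplittingAtInfinity → BakryEmeryLogSobolev → ConicalGap → UnboundedCurvatureGap →
NoncompactShrinkerGap. Content: trichotomy on the scalar curvature at infinity (two `by_cases` +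
`exists_nondecaying_of_not_flatAtInfinity`,
Theorems/EntropyRungNoncompactShrinkerGapReduction.lean): unbounded R → UnboundedCurvatureGap;
bounded R decaying to 0 → ConicalGap; bounded non-decaying R → the Bernstein–Wang lever
`collapsedDirectionReduction_of_textbook`
(Theorems/EntropyRungNoncompactShrinkerGapReductionTextbook.lean, p116509: from F1 =
ShrinkerSplittingAtInfinity the complete non-flat normalised 3-d shrinker N at infinity and the
transplants; from the landed U2/U3/U1-ff (p98265, p93265, p114898) and the Bakry–Émery LSI =
BakryEmeryLogSobolev (bridged to `bakryEmery_logSobolev_complete` by riemVolume_eq / riemEDist_eq)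
the semicontinuity ∫_M e^{−f} ≤ 2√π ∫_N e^{−φ}), then ThreeShrinkerGap caps ∫_N e^{−φ} ≤ 16π -/
@[route_item "route-SmoothPoincare4-EntropyRung"]
def NoncompactGapReduction : Prop :=
  ThreeShrinkerGap → ShrinkerSplittingAtInfinity → BakryEmeryLogSobolev → ConicalGap → UnboundedCurvatureGap → NoncompactShrinkerGap

/-- item stmt-SmoothPoincare4-17634 · support · rank 9 · open · by planner
sources: Bamler2020Structure, Bamler2023, Bamler2020Entropy, arXiv:2009.03243, arXiv:2008.09298 -/
@[route_item "route-SmoothPoincare4-EntropyRung", crux]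
def ShrinkerEmerges : Prop :=
  ∀ (M : Type) [TopologicalSpace M] [T2Space M] [SecondCountableTopology M] [ChartedSpace (EuclideanSpace ℝ (Fin 4)) M] [IsManifold (𝓡 4) ∞ M] [CompactSpace M] [ConnectedSpace M] [T3Space M] [MeasurableSpace M] [BorelSpace M] (g : Literature.Geometry.Lorentzian.PseudoRiemannianMetric (𝓡 4) ∞ (EuclideanSpace ℝ (Fin 4)) (TangentSpace (𝓡 4) : M → Type _)) [g.HasLeviCivita] (hg : g.IsRiemannian), (∀ x : M, 0 < g.scalarCurvature x) → (∃ δ : ℝ, 0 < δ ∧ ∀ τ : ℝ, 0 < τ → ∀ f : M → ℝ, ContMDiff (𝓡 4) 𝓘(ℝ, ℝ) ∞ f → ∫ x, (4 * Real.pi * τ) ^ (-(4 : ℝ) / 2) * Real.exp (-f x) ∂(Literature.Geometry.Lorentzian.riemannianMeasure (g.toContMDiffRiemannianMetric hg)) = 1 → Real.log 2 + Real.log Real.pi / 2 - 3 / 2 + δ ≤ ∫ x, (τ * (g.scalarCurvature x + g.gradSq f x) + f x - 4) * ((4 * Real.pi * τ) ^ (-(4 : ℝ) / 2) * Real.exp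 (-f x)) ∂(Literature.Geometry.Lorentzian.riemannianMeasure (g.toContMDiffRiemannianMetric hg))) → ∃ (S : Type) (_ : TopologicalSpace S) (_ : T2Space S) (_ : SecondCountableTopology S) (_ : ChartedSpace (EuclideanSpace ℝ (Fin 4)) S) (_ : IsManifold (𝓡 4) ∞ S) (_ : ConnectedSpace S) (_ : T3Space S) (_ : MeasurableSpace S) (_ : BorelSpace S) (gS : Literature.Geometry.Lorentzian.PseudoRiemannianMetric (𝓡 4) ∞ (EuclideanSpace ℝ (Fin 4)) (TangentSpace (𝓡 4) : S → Type _)) (_ : gS.HasLeviCivita) (fS : S → ℝ) (hS : gS.IsRiemannian), (∀ (x : S) (r : NNReal), IsCompact {y : S | gS.edist hS x y ≤ r}) ∧ ContMDiff (𝓡 4) 𝓘(ℝ, ℝ) ∞ fS ∧ (∀ (x : S) (X Y : TangentSpace (𝓡 4) x), gS.ricci x X Y + gS.hessian fS x X Y = (1 / 2 : ℝ) * gS.val x X Y) ∧ (∀ x : S, gS.scalarCurvature x + gS.gradSq fS x = fS x) ∧ (∃ x : S, gS.scalarCurvature x ≠ 0) ∧ ENNReal.ofReal (32 * Real.pi ^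 2 * Real.sqrt Real.pi * Real.exp (-(3 : ℝ) / 2)) < ∫⁻ x, ENNReal.ofReal (Real.exp (-fS x)) ∂(Literature.Geometry.Lorentzian.riemannianMeasure (gS.toContMDiffRiemannianMetric hS)) ∧ (CompactSpace S → ∃ φ : S → M, ContMDiff (𝓡 4) (𝓡 4) ∞ φ ∧ Function.Injective φ ∧ ∀ x : S, Function.Injective (mfderiv (𝓡 4) (𝓡 4) φ x))

/-- item stmt-SmoothPoincare4-18300 · support · rank 9 · closed · proved by Summit.SmoothPoincare4.SmoothPoincare4.Theorems.recognitionOfEmergence_proof @ f24f9d069eef (planner) · by planner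
sources: Bamler2020Structure, CaoHamiltonIlmanen2004, Perelman2002Entropy
[support] GLUE (crux-strategist r1, DECOMPOSITION of crux #3 SubcylindricalRecognition = RUNG into
three open leaves, none the summit): ShrinkerEmerges → NoncompactShrinkerGap → CompactShrinkerGap →
SubcylindricalRecognition. PROVABLE NOW, fact-free and sorry-free (strategist s1's
`subcylindricalRecognition_of_shrinkerEmerges`,
Cruxes/SubcylindricalRecognition/StrategistSketchS1.lean, re-landed by r1 as
Theorems/EntropyRungRecognitionOfEmergence.lean): given the emerging complete non-flat normalised
shrinker S of Gaussian mass > 32π²√π e^{−3/2} (density > Θ(S³×ℝ)), a non-compact S contradicts #2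
(mass ≤ bound); a compact S immerses injectively and smoothly into the connected M ≃ₕ S⁴, hence is
diffeomorphic to M (`stub_compactModelRecognition`, landed p72507: injective immersion of a closed
4-manifold into a connected 4-manifold is a diffeomorphism), so S ≃ₕ S⁴ carries a dense compact
shrinker and #4 returns S ≅ S⁴, whence M ≅ S⁴. With this glue proved, RUNG is DERIVED from:
ShrinkerEmerges (stmt-17634; the SPC4-free analytic core = Bamler 2020a–c tangent flow at −∞ in
route vocabulary; probes ShrinkerEmerges → SmoothPoincare4 and SmoothPoincare4 → ShrinkerEmerges
both fail, s1 Prob -/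
@[route_item "route-SmoothPoincare4-EntropyRung"]
def RecognitionOfEmergence : Prop :=
  ShrinkerEmerges → NoncompactShrinkerGap → CompactShrinkerGap → SubcylindricalRecognition

/-- item stmt-SmoothPoincare4-6812 · assembly · rank 1 · closed · proved by Summit.SmoothPoincare4.SmoothPoincare4.Theorems.entropyRung_assembly_proof @ a2447a268549 (prover) · by planner
sources: HatcherAT2002, Perelman2002Entropy, CaoHamiltonIlmanen2004
[assembly] SubcylindricalRecognition → SubcylindricalExistence → SmoothPoincare4 (provable now;
proof in Sketch.lean). -/
@[route_item "route-SmoothPoincare4-EntropyRung"]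
def Assembly : Prop :=
  SubcylindricalRecognition → SubcylindricalExistence → SmoothPoincare4

/-! D-0027 §2.1 — DECIDING THEOREM (planner-authored via `route open/edit --closes-file`; by planner-rbadge-SmoothPoincare4-EntropyRung-77b91637-g4-0 2026-08-15T16:25:34Z):
its hypotheses are this route's items and its conclusion the sub-problem Statement (glue_lint), and it elaborates with this file. -/

@[closes "route-SmoothPoincare4-EntropyRung"] theorem closes (hRung : SubcylindricalRecognition) (hEnt : SubcylindricalExistence) : _root_.SmoothPoincare4 := by
  -- SPC4 (Mathlib form): for a Hausdorff second-countable `M`, any `C^∞` atlas on `ℝ⁴` and `e : M ≃ₕ S⁴`, give `M ≃ₘ S⁴`.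
  intro M _ _ _ _ _ e
  -- `M ≃ₕ S⁴` ⇒ `M` compact (Hatcher Prop. 3.29, PROVED in the tree: no named fact enters as a hypothesis);
  -- compact + T₂ ⇒ T₃ (Mathlib instances); the Borel σ-algebra discharges `[MeasurableSpace M] [BorelSpace M]`.
  haveI : CompactSpace M :=
    Literature.Topology.FourManifolds.compactSpace_of_homotopyEquiv_sphere_four_holds M e
  letI : MeasurableSpace M := borel M
  haveI : BorelSpace M := ⟨rfl⟩
  -- ENT: a Riemannian metric `g` (with Levi-Civita connection) with `R > 0` and `ν(g) > ν_cyl`; RUNG recognises `S⁴` from it.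
  obtain ⟨g, hLC, hg, hR, hν⟩ := hEnt M e
  exact hRung M e g hg hR hν

end Summit.SmoothPoincare4.SmoothPoincare4.Theses.EntropyRung
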